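import Summits.AtomisticToContinuum.FouriersLaw.Theorems.EmbeddedDrudeMourreDrudeDissolutionStubPencilDerivationAlgebra
import HarnessLib

/-!
# Stub K `stub_freeForceKernel`, the first-order force `Φ` as an explicit local polynomial
(line `gram-pencil-harmonic-chaos`, crux `EmbeddedDrudeMourre.DrudeDissolution`,
item stmt-AtomisticToContinuum-12593; `--supports` file, closes nothing)

WHAT. The vector of stub K is the FIRST-ORDER FORCE ON THE CURRENT along the coupling ray,
`Φ = (𝓛_{(a,b)} − 𝓛_{(0,0)}) j⁽²⁾₀ + b·(𝓛_{(0,0)} j⁽⁴⁾'₀ − 𝓛_{(0,0)} j⁽²⁾₀)`, written in the statement with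
the intrinsic tree functions `liouvilleZ`, `bondCurrentZ`, `pinnedChain`. This file CHECKS the planning
docstring's closed form against the intrinsic definition:

`Φ = (3b/2)(p₀² − p₁²) r₀² + (a/2) r₀ (q₀³ + q₁³) − (b/2) r₀ (r₁³ − r₋₁³) + (bω₂/2) r₀³ (q₀ + q₁)
     − (b/2) r₀³ (r₁ − r₋₁)`, `r_x = q_{x+1} − q_x`

(`firstOrderForce_apply`, registered helper), from the general formula for the Liouville operator of
ANY chain applied to the bond current of a `pinnedChain` (`liouvilleZ_bondCurrentZ_pinnedChain`):
`𝓛_P j^{(β)}_0 = −[(F^P_0 + F^P_1)/2 · (r₀ + β r₀³) + (p₀ + p₁)/2 · (1 + 3β r₀²)(p₁ − p₀)]`.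

HOW. The bond current is `MvPolynomial.eval` of a polynomial in the four letters `p₀, p₁, q₀, q₁`
(`bondCurrentZ_pinnedChain_eq_eval`), so worker C's `liouvilleZ_localPolynomial_apply` turns `liouvilleZ`
into a four-term sum of forces/momenta times formal partial derivatives, evaluated by `simp` + `ring`.
-/

noncomputable section

open MeasureTheory Filter Set Function Topology
open scoped InnerProductSpace ENNReal
open Literature.MathematicalPhysics.KineticTheory
open Literature.MathematicalPhysics.KineticTheory.HeatConduction
open Literature.MathematicalPhysics.KineticTheory.PhononBoltzmann
open MvPolynomial

namespace Summit.AtomisticToContinuum.FouriersLaw.Theorems.DrudeDissolution.GramPencilHarmonicChaos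

/-- The forces of `pinnedChain ω₂ lam β γ`: `F_i = −(ω₂ q_i + lam q_i³) + V′(r_i) − V′(r_{i−1})`,
`V′(r) = r + β r³`. [folklore] -/
theorem force_pinnedChain_apply (ω₂ lam β γ : ℝ) (σ : ChainConfig) (i : ℤ) :
    (pinnedChain ω₂ lam β γ).force σ i =
      -(ω₂ * (σ i).1 + lam * (σ i).1 ^ 3) +
        ((((σ (i + 1)).1 - (σ i).1) + β * ((σ (i + 1)).1 - (σ i).1) ^ 3) -
          (((σ i).1 - (σ (i - 1)).1) + β * ((σ i).1 - (σ (i - 1)).1) ^ 3)) := by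
  simp only [OscillatorChain.force, OscillatorChain.interactionForce, pinnedChain_deriv_U,
    pinnedChain_deriv_V]

/-- The bond current `j^{(β)}_0 = −½(p₀ + p₁)(r₀ + β r₀³)` of `pinnedChain ω₂ lam β γ` is the evaluation
of a polynomial in the letters `p₀, p₁, q₀, q₁`. [folklore] -/
theorem bondCurrentZ_pinnedChain_eq_eval (ω₂ lam β γ : ℝ) :
    (fun σ : ChainConfig => (pinnedChain ω₂ lam β γ).bondCurrentZ σ 0) =
      fun σ : ChainConfig => MvPolynomial.eval (fun i : Fin 4 => (if ((![((0 : ℤ), true), (1, true), (0, false), (1, false)] : Fin 4 → ℤ × Bool) i).2 then (σ ((![((0 : ℤ), true), (1, true), (0, false), (1, false)] : Fin 4 → ℤ × Bool) i).1).2 else (σ ((![((0 : ℤ), true), (1, true), (0, false), (1, false)] : Fin 4 → ℤ × Bool) i).1).1))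
        ((C (-(1 / 2 : ℝ)) * (X 0 + X 1) * ((X 3 - X 2) + C β * (X 3 - X 2) ^ 3) : MvPolynomial (Fin 4) ℝ)) := by
  funext σ
  have h0 : (![((0 : ℤ), true), (1, true), (0, false), (1, false)] : Fin 4 → ℤ × Bool) 0 = (0, true) := rfl
  have h1 : (![((0 : ℤ), true), (1, true), (0, false), (1, false)] : Fin 4 → ℤ × Bool) 1 = (1, true) := rfl
  have h2 : (![((0 : ℤ), true), (1, true), (0, false), (1, false)] : Fin 4 → ℤ × Bool) 2 = (0, false) := rfl
  have h3 : (![((0 : ℤ), true), (1, true), (0, false), (1, false)] : Fin 4 → ℤ × Bool) 3 = (1, false) := rfl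
  simp only [OscillatorChain.bondCurrentZ, pinnedChain_deriv_V, map_mul, map_add, map_sub, map_pow,
    eval_C, eval_X, h0, h1, h2, h3, if_true, Bool.false_eq_true, if_false, zero_add]
  ring

/-- **The Liouville operator of ANY chain on the bond current of a `pinnedChain`**:
`𝓛_P j^{(β)}_0 = −[(F^P_0 + F^P_1)/2 · (r₀ + β r₀³) + (p₀+p₁)/2 · (1 + 3β r₀²) · (p₁ − p₀)]`.
[folklore] -/
theorem liouvilleZ_bondCurrentZ_pinnedChain (P : OscillatorChain) (ω₂ lam β γ : ℝ) (σ : ChainConfig) :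
    liouvilleZ P (fun σ => (pinnedChain ω₂ lam β γ).bondCurrentZ σ 0) σ =
      -((P.force σ 0 + P.force σ 1) / 2 * (((σ 1).1 - (σ 0).1) + β * ((σ 1).1 - (σ 0).1) ^ 3) +
        ((σ 0).2 + (σ 1).2) / 2 * (1 + 3 * β * ((σ 1).1 - (σ 0).1) ^ 2) * ((σ 1).2 - (σ 0).2)) := by
  rw [bondCurrentZ_pinnedChain_eq_eval, liouvilleZ_localPolynomial_apply]
  simp only [Fin.sum_univ_four, Matrix.cons_val_zero, Matrix.cons_val_one, Matrix.cons_val,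
    map_mul, map_add, map_sub, map_pow, eval_C, eval_X, Derivation.leibniz, Derivation.leibniz_pow,
    pderiv_C, pderiv_X, smul_eq_mul, map_zero]
  simp
  ring

/-- **Registered helper (stub K): the first-order force on the current is the docstring's explicit
degree-4 local polynomial.** With `r_x = q_{x+1} − q_x`:
`(𝓛_{(a,b)} − 𝓛_{(0,0)}) j⁽²⁾₀ + b(𝓛_{(0,0)} j⁽⁴⁾'₀ − 𝓛_{(0,0)} j⁽²⁾₀)
  = (3b/2)(p₀²−p₁²)r₀² + (a/2)r₀(q₀³+q₁³) − (b/2)r₀(r₁³−r₋₁³) + (bω₂/2)r₀³(q₀+q₁) − (b/2)r₀³(r₁−r₋₁)`.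
[folklore] -/
theorem firstOrderForce_apply : ∀ (ω₂ a b : ℝ) (σ : Literature.MathematicalPhysics.KineticTheory.HeatConduction.ChainConfig), Literature.MathematicalPhysics.KineticTheory.HeatConduction.liouvilleZ (Literature.MathematicalPhysics.KineticTheory.HeatConduction.pinnedChain ω₂ a b 1) (fun σ => (Literature.MathematicalPhysics.KineticTheory.HeatConduction.pinnedChain ω₂ 0 0 1).bondCurrentZ σ 0) σ - Literature.MathematicalPhysics.KineticTheory.HeatConduction.liouvilleZ (Literature.MathematicalPhysics.KineticTheory.HeatConduction.pinnedChain ω₂ 0 0 1) (fun σ => (Literature.MathematicalPhysics.KineticTheory.HeatConduction.pinnedChain ω₂ 0 0 1).bondCurrentZ σ 0) σ + b * (Literature.MathematicalPhysics.KineticTheory.HeatConduction.liouvilleZ (Literature.MathematicalPhysics.KineticTheory.HeatConduction.pinnedChain ω₂ 0 0 1) (fun σ => (Literature.MathematicalPhysics.KineticTheory.HeatConduction.pinnedChain ω₂ 0 1 1).bondCurrentZ σ 0) σ - Literature.MathematicalPhysics.KineticTheory.HeatConduction.liouvilleZ (Literature.MathematicalPhysics.KineticTheory.HeatConduction.pinnedChain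 ω₂ 0 0 1) (fun σ => (Literature.MathematicalPhysics.KineticTheory.HeatConduction.pinnedChain ω₂ 0 0 1).bondCurrentZ σ 0) σ) = 3 * b / 2 * ((σ 0).2 ^ 2 - (σ 1).2 ^ 2) * ((σ 1).1 - (σ 0).1) ^ 2 + a / 2 * ((σ 1).1 - (σ 0).1) * ((σ 0).1 ^ 3 + (σ 1).1 ^ 3) - b / 2 * ((σ 1).1 - (σ 0).1) * (((σ 2).1 - (σ 1).1) ^ 3 - ((σ 0).1 - (σ (-1)).1) ^ 3) + b * ω₂ / 2 * ((σ 1).1 - (σ 0).1) ^ 3 * ((σ 0).1 + (σ 1).1) - b / 2 * ((σ 1).1 - (σ 0).1) ^ 3 * (((σ 2).1 - (σ 1).1) - ((σ 0).1 - (σ (-1)).1)) := by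
  intro ω₂ a b σ
  simp only [liouvilleZ_bondCurrentZ_pinnedChain, force_pinnedChain_apply]
  norm_num
  ring

end Summit.AtomisticToContinuum.FouriersLaw.Theorems.DrudeDissolution.GramPencilHarmonicChaos

end
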